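/-
Copyright (c) 2026 the pub-hodgecm-mathlib formalisation cell (harness21).  Prover seat hodgecm-mathlib-K2Liu-p13 (g2), Track B «K2-LIT»,
#184♮ = hLiu418 = `stmt-HodgeConjecture-24832`; Road I v3 organ U1-CT-ind STAGE 2 (Q2), file F5-m (the membership law `hΓΛ` of ★∕📤 F5-l from ★ F5-a's `hΓ₁`).
-/
import Summits.HodgeConjecture.HodgeConjecture.Theorems.K2LiuKlingenCellXiOrbits     -- ★ F4-3b: `exists_mem_klingenUnip_of_mem_ratH`, `isSiegelDelta_conj_transport_iff_exists_uPlus`, `toAdelic_nKlingen_eq_jAdelic`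
import Literature.NumberTheory.Automorphic.AdelicSecondCountable     -- ★ `NumberField.countable'`
import HarnessLib

/-!
# Crux `HLiu418`, Road I v3, organ U1 stage 2 (Q2), file F5-m: THE STABILISER LATTICE OF THE `ξ`-CELL IS `Ψ(u₊(ι L))` —
# ★ F5-a's membership law `u ∈ Γ₁ ↔ ↑u ∈ H(L⁺) ∧ Ψ(ξ)·u·Ψ(ξ)⁻¹ ∈ P_Δ(𝔸)` EQUALS ★ F5-l's `∃ l ∈ Λ, ↑u = Ψ(u₊(l))` with `Λ = ι(L) ≤ 𝔸_L`

Cell `hodgecm-mathlib`, crux item hLiu418 = `stmt-HodgeConjecture-24832`; squad K2 ∕ K2Liu; LEAD F0P6-plan (g14), co-dealer K2E5-plan (g7); prover K2Liu-p13 (g2).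
THEOREMS ONLY (no `def`, no instance, no notation, no named-fact hypothesis, no `sorry`); lane `--supports stmt-HodgeConjecture-24832 --as helper` (count-neutral).
* `toAdelic_uPlus_eq_jAdelic` — rational versus adelic letter: `toAdelic₄ (u₊^L(z)) = jAdelic (u₊^𝔸(ι z))`;
* **`mem_stab_iff_exists_uPlus`** — for `u ∈ N_Q(𝔸)`: `(↑u ∈ H(L⁺) ∧ Ψ(toAdelic ξ)·u·Ψ(toAdelic ξ)⁻¹ ∈ P_Δ(𝔸)) ↔ ∃ l ∈ (ι : L →+ 𝔸_L).range, ↑u = Ψ(jAdelic (u₊^𝔸 l))`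
  (⇒: ★ F4-3b `exists_mem_klingenUnip_of_mem_ratH` + `isSiegelDelta_conj_transport_iff_exists_uPlus` at `m = 1`; ⇐: rational letters lie in `H(L⁺)`, `ξ u₊ ξ⁻¹ ∈ P`);
* **`stab_membership_law`** — hence ★ F5-a `hasSum_cellXi`'s `hΓ₁` gives ★ F5-l's `hΓΛ` with `Λ := (algebraMap L 𝔸_L).toAddMonoidHom.range` (countable: `countable_range_algebraMap`).
[Xiong2013, §7 Lemma 7.1], [GanTakeda2011SiegelWeil, §7.2 p. 23], [MoeglinWaldspurger1995, II.1.7].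
HONEST LABEL.  Count-neutral helper: `HC_CM` is proved only modulo the 7 printed citations (2 remaining named inputs: hLiu418 = `stmt-HodgeConjecture-24832`,
h413 = `stmt-HodgeConjecture-24833`) until rung 0 closes.
-/

set_option autoImplicit false
set_option linter.dupNamespace false -- the mandated namespace repeats `HodgeConjecture.HodgeConjecture`

noncomputable section

open scoped Matrix
open NumberField IsDedekindDomain

namespace Summit.HodgeConjecture.HodgeConjecture.Cruxes.HLiu418.K2LiuKlingenStabiliserLattice

open Literature.NumberTheory.Automorphic Literature.NumberTheory.Automorphic.UnitaryGroup
open Literature.NumberTheory.GelbartRogawski1991 Literature.NumberTheory.GelbartRogawski1991.GRConstruction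
open Literature.NumberTheory.GaloisRepresentations
open Literature.NumberTheory.K2Lit.SiegelDoubled
open Summit.HodgeConjecture.HodgeConjecture.Cruxes.HLiu418.K2LiuDoubledUTwoTwoBorelFrame
open Summit.HodgeConjecture.HodgeConjecture.Cruxes.HLiu418.K2LiuKlingenParabolicDefs
open Summit.HodgeConjecture.HodgeConjecture.Cruxes.HLiu418.K2LiuKlingenUnipotentDefs
open Summit.HodgeConjecture.HodgeConjecture.Cruxes.HLiu418.K2LiuKlingenUnipotentAdelicDefs
open Summit.HodgeConjecture.HodgeConjecture.Cruxes.HLiu418.K2LiuKlingenRationalCells (complexConj_ringHom_apply_apply transport_toAdelic_mem_ratH)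
open Summit.HodgeConjecture.HodgeConjecture.Cruxes.HLiu418.K2LiuKlingenCellXiOrbits
open Summit.HodgeConjecture.HodgeConjecture.Cruxes.HLiu418.K2LiuSiegelDoubledLeviMatrix (conjAdele_conjAdele')
open UnitaryDualPair

variable {L : Type} [Field L] [NumberField L] [IsCMField L]
variable {N M : ℕ} {e : Fin N × Fin M ≃ Fin 2}
  {dV : Fin N → L} {hdV : ∀ i, IsCMField.complexConj L (dV i) = dV i}
  {dW : Fin M → L} {hdW : ∀ i, IsCMField.complexConj L (dW i) = dW i}

section Transport

variable {SA : GL (Fin (2 + 2)) (AdeleRing (𝓞 L) L)}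
  {Ψ : (quasiSplit (Fp L) L (IsCMField.complexConj L) (2 + 2)).Adelic ≃ₜ* HA L e dV hdV dW hdW} {X Y : Matrix (Fin 2) (Fin 2) (Fp L)} {a : Fp L}
  (hΨ : ∀ g : (quasiSplit (Fp L) L (IsCMField.complexConj L) (2 + 2)).Adelic,
    (((Ψ g : HA L e dV hdV dW hdW) : GL (Fin (2 + 2)) (AdeleRing (𝓞 L) L)) : Matrix (Fin (2 + 2)) (Fin (2 + 2)) (AdeleRing (𝓞 L) L)) =
      (SA : Matrix (Fin (2 + 2)) (Fin (2 + 2)) (AdeleRing (𝓞 L) L)) *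
        ((adelicVal (Fp L) L (IsCMField.complexConj L) (2 + 2) _ g : GL (Fin (2 + 2)) (AdeleRing (𝓞 L) L)) :
          Matrix (Fin (2 + 2)) (Fin (2 + 2)) (AdeleRing (𝓞 L) L)) *
        ((SA⁻¹ : GL (Fin (2 + 2)) (AdeleRing (𝓞 L) L)) : Matrix (Fin (2 + 2)) (Fin (2 + 2)) (AdeleRing (𝓞 L) L)))
  (ha : a + a = 1)
  (hSA : Matrix.reindex (e₂ (n := 2)).symm (e₂ (n := 2)).symm (SA : Matrix (Fin (2 + 2)) (Fin (2 + 2)) (AdeleRing (𝓞 L) L)) =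
    Matrix.fromBlocks (1 : Matrix (Fin 2) (Fin 2) (AdeleRing (𝓞 L) L)) (X.map ((algebraMap L (AdeleRing (𝓞 L) L)).comp (algebraMap (Fp L) L))) 1
      (-(X.map ((algebraMap L (AdeleRing (𝓞 L) L)).comp (algebraMap (Fp L) L)))))
  (hSAi : Matrix.reindex (e₂ (n := 2)).symm (e₂ (n := 2)).symm ((SA⁻¹ : GL (Fin (2 + 2)) (AdeleRing (𝓞 L) L)) : Matrix (Fin (2 + 2)) (Fin (2 + 2)) (AdeleRing (𝓞 L) L)) =
    Matrix.fromBlocks ((a • (1 : Matrix (Fin 2) (Fin 2) (Fp L))).map ((algebraMap L (AdeleRing (𝓞 L) L)).comp (algebraMap (Fp L) L)))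
      ((a • (1 : Matrix (Fin 2) (Fin 2) (Fp L))).map ((algebraMap L (AdeleRing (𝓞 L) L)).comp (algebraMap (Fp L) L)))
      (Y.map ((algebraMap L (AdeleRing (𝓞 L) L)).comp (algebraMap (Fp L) L)))
      (-(Y.map ((algebraMap L (AdeleRing (𝓞 L) L)).comp (algebraMap (Fp L) L)))))
  (hXY : X * Y = a • (1 : Matrix (Fin 2) (Fin 2) (Fp L))) (hYX : Y * X = a • (1 : Matrix (Fin 2) (Fin 2) (Fp L)))

/-- **rational versus adelic `u₊` letters**: `toAdelic₄ (u₊^L(z)) = jAdelic (u₊^𝔸(ι z))` (★ F4-3b `toAdelic_nKlingen_eq_jAdelic`, `u₊ = n_Q(0,·,0)`).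
[cite: Xiong2013, §7 Lemma 7.1] [cite: Mok2014, §1 Notation p. 5] -/
theorem toAdelic_uPlus_eq_jAdelic (z : L) :
    UnitaryGroup.toAdelic (Fp L) L (IsCMField.complexConj L) (2 + 2) ((StdForm.antidiagonal (2 + 2)).over L) (uPlus L ((IsCMField.complexConj L : L ≃ₐ[Fp L] L) : L →+* L) (complexConj_ringHom_apply_apply L) z) =
      jAdelic L 4 (uPlus (AdeleRing (𝓞 L) L) (conjAdele (Fp L) L (IsCMField.complexConj L)) (conjAdele_conjAdele' L) (algebraMap L (AdeleRing (𝓞 L) L) z)) := by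
  rw [uPlus_eq_nKlingen, uPlus_eq_nKlingen, toAdelic_nKlingen_eq_jAdelic]
  exact congrArg (jAdelic L 4) (K2LiuKlingenInnerSectionLeviLaw_free_congr (map_zero _) rfl (map_zero _))
where
  /-- `n_Q` letters with equal coordinates are equal. [cite: Xiong2013, §7 Lemma 7.1] -/
  K2LiuKlingenInnerSectionLeviLaw_free_congr {y y' : AdeleRing (𝓞 L) L} {hy : conjAdele (Fp L) L (IsCMField.complexConj L) y = -y} {hy' : conjAdele (Fp L) L (IsCMField.complexConj L) y' = -y'} {z z' t t' : AdeleRing (𝓞 L) L}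
      (h1 : y = y') (h2 : z = z') (h3 : t = t') :
      nKlingen (AdeleRing (𝓞 L) L) (conjAdele (Fp L) L (IsCMField.complexConj L)) (conjAdele_conjAdele' L) y hy z t = nKlingen (AdeleRing (𝓞 L) L) (conjAdele (Fp L) L (IsCMField.complexConj L)) (conjAdele_conjAdele' L) y' hy' z' t' := by
    subst h1 h2 h3; rfl

include hΨ ha hSA hSAi hXY hYX in
/-- **THE STABILISER MEMBERSHIP LAW IN `u₊`-LETTERS**: for `u ∈ N_Q(𝔸)`,
`(↑u ∈ H(L⁺) ∧ Ψ(toAdelic ξ)·u·Ψ(toAdelic ξ)⁻¹ ∈ P_Δ(𝔸)) ↔ ∃ l ∈ range ι, ↑u = Ψ(jAdelic (u₊^𝔸(l)))`.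
[cite: Xiong2013, §7 Lemma 7.1] [cite: GanTakeda2011SiegelWeil, §7.2 p. 23] [cite: MoeglinWaldspurger1995, II.1.7] -/
theorem mem_stab_iff_exists_uPlus (u : ↥(klingenUnipA Ψ)) :
    ((u : HA L e dV hdV dW hdW) ∈ ratH L e dV hdV dW hdW ∧
        IsSiegelDelta L e dV hdV dW hdW (Ψ (UnitaryGroup.toAdelic (Fp L) L (IsCMField.complexConj L) (2 + 2) ((StdForm.antidiagonal (2 + 2)).over L) (weylXi L ((IsCMField.complexConj L : L ≃ₐ[Fp L] L) : L →+* L))) * (u : HA L e dV hdV dW hdW) * (Ψ (UnitaryGroup.toAdelic (Fp L) L (IsCMField.complexConj L) (2 + 2) ((StdForm.antidiagonal (2 + 2)).over L) (weylXi L ((IsCMField.complexConj L : L ≃ₐ[Fp L] L) : L →+* L))))⁻¹)) ↔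
      ∃ l ∈ (algebraMap L (AdeleRing (𝓞 L) L)).toAddMonoidHom.range, (u : HA L e dV hdV dW hdW) = Ψ (jAdelic L 4 (uPlus (AdeleRing (𝓞 L) L) (conjAdele (Fp L) L (IsCMField.complexConj L)) (conjAdele_conjAdele' L) (l))) := by
  constructor
  · rintro ⟨hur, hP⟩
    obtain ⟨n, hn, hun⟩ := exists_mem_klingenUnip_of_mem_ratH hΨ ha hSA hSAi hXY hYX u.2 hur
    have hP' : IsSiegelDelta L e dV hdV dW hdW
        (Ψ (UnitaryGroup.toAdelic (Fp L) L (IsCMField.complexConj L) (2 + 2) ((StdForm.antidiagonal (2 + 2)).over L) ((weylXi L ((IsCMField.complexConj L : L ≃ₐ[Fp L] L) : L →+* L)) * (1 : unitaryGroupOfForm ((IsCMField.complexConj L : L ≃ₐ[Fp L] L) : L →+* L) ((StdForm.antidiagonal 4).over L)))) * Ψ (UnitaryGroup.toAdelic (Fp L) L (IsCMField.complexConj L) (2 + 2) ((StdForm.antidiagonal (2 + 2)).over L) n) * (Ψ (UnitaryGroup.toAdelic (Fp L) L (IsCMField.complexConj L) (2 + 2) ((StdForm.antidiagonal (2 + 2)).over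 L) ((weylXi L ((IsCMField.complexConj L : L ≃ₐ[Fp L] L) : L →+* L)) * (1 : unitaryGroupOfForm ((IsCMField.complexConj L : L ≃ₐ[Fp L] L) : L →+* L) ((StdForm.antidiagonal 4).over L)))))⁻¹) := by
      rw [mul_one, ← hun]; exact hP
    obtain ⟨z, hz⟩ := (isSiegelDelta_conj_transport_iff_exists_uPlus hΨ ha hSA hSAi hYX
      (klingen L ((IsCMField.complexConj L : L ≃ₐ[Fp L] L) : L →+* L)).one_mem hn).1 hP'
    rw [one_mul, inv_one, mul_one] at hz
    refine ⟨algebraMap L (AdeleRing (𝓞 L) L) z, ⟨z, rfl⟩, ?_⟩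
    rw [hun, hz, toAdelic_uPlus_eq_jAdelic]
  · rintro ⟨l, ⟨z, rfl⟩, hu⟩
    have hu' : (u : HA L e dV hdV dW hdW) = Ψ (UnitaryGroup.toAdelic (Fp L) L (IsCMField.complexConj L) (2 + 2) ((StdForm.antidiagonal (2 + 2)).over L) (uPlus L ((IsCMField.complexConj L : L ≃ₐ[Fp L] L) : L →+* L) (complexConj_ringHom_apply_apply L) z)) := by
      rw [hu]; exact congrArg Ψ (toAdelic_uPlus_eq_jAdelic z).symm
    refine ⟨by rw [hu']; exact transport_toAdelic_mem_ratH hΨ ha hSA hSAi hXY hYX _, ?_⟩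
    have hP' := (isSiegelDelta_conj_transport_iff_exists_uPlus hΨ ha hSA hSAi hYX (e := e) (dV := dV) (hdV := hdV) (dW := dW) (hdW := hdW)
      ((klingen L ((IsCMField.complexConj L : L ≃ₐ[Fp L] L) : L →+* L)).one_mem)
      (uPlus_mem_klingenUnip (complexConj_ringHom_apply_apply L) z)).2 ⟨z, by rw [one_mul, inv_one, mul_one]⟩
    rw [mul_one] at hP'
    rw [hu']
    exact hP'

include hΨ ha hSA hSAi hXY hYX in
/-- **★ F5-a's `hΓ₁` ⟹ ★ F5-l's `hΓΛ`** with `Λ := range (ι : L →+ 𝔸_L)`: the stabiliser lattice `Γ₁` of the `ξ`-cell is `Ψ(u₊(ι L))`.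
[cite: Xiong2013, §7 Lemma 7.1] [cite: MoeglinWaldspurger1995, II.1.7] -/
theorem stab_membership_law (Γ₁ : Subgroup ↥(klingenUnipA Ψ))
    (hΓ₁ : ∀ u : ↥(klingenUnipA Ψ), u ∈ Γ₁ ↔ (u : HA L e dV hdV dW hdW) ∈ ratH L e dV hdV dW hdW ∧
      IsSiegelDelta L e dV hdV dW hdW (Ψ (UnitaryGroup.toAdelic (Fp L) L (IsCMField.complexConj L) (2 + 2) ((StdForm.antidiagonal (2 + 2)).over L) (weylXi L ((IsCMField.complexConj L : L ≃ₐ[Fp L] L) : L →+* L))) * (u : HA L e dV hdV dW hdW) * (Ψ (UnitaryGroup.toAdelic (Fp L) L (IsCMField.complexConj L) (2 + 2) ((StdForm.antidiagonal (2 + 2)).over L) (weylXi L ((IsCMField.complexConj L : L ≃ₐ[Fp L] L) : L →+* L))))⁻¹))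
    (γ : ↥(klingenUnipA Ψ)) :
    γ ∈ Γ₁ ↔ ∃ l ∈ (algebraMap L (AdeleRing (𝓞 L) L)).toAddMonoidHom.range, (γ : HA L e dV hdV dW hdW) = Ψ (jAdelic L 4 (uPlus (AdeleRing (𝓞 L) L) (conjAdele (Fp L) L (IsCMField.complexConj L)) (conjAdele_conjAdele' L) (l))) :=
  (hΓ₁ γ).trans (mem_stab_iff_exists_uPlus hΨ ha hSA hSAi hXY hYX γ)

omit [IsCMField L] in
/-- `ι(L) ≤ 𝔸_L` is countable. [cite: Mok2014, §1 Notation p. 5] -/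
theorem countable_range_algebraMap : Countable ↥((algebraMap L (AdeleRing (𝓞 L) L)).toAddMonoidHom.range) := by
  haveI : Countable L := NumberField.countable' (K := L)
  exact Set.countable_range (algebraMap L (AdeleRing (𝓞 L) L)) |>.to_subtype

end Transport

end Summit.HodgeConjecture.HodgeConjecture.Cruxes.HLiu418.K2LiuKlingenStabiliserLattice

end
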